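import Mathlib
import Literature.Analysis.FluidPDE.SuitableWeak
import Literature.Analysis.FluidPDE.Seregin2023.TypeIIEulerZoom
import Literature.Analysis.FluidPDE.ClassicalLocalEnergyCutoff
import Literature.Analysis.FluidPDE.MildSolutionProofs
import Literature.Analysis.FluidPDE.WholeSpaceIBP
import Summits.NavierStokesRegularity.NavierStokesRegularity.Theses.EulerZoomLiouville
import Summits.NavierStokesRegularity.NavierStokesRegularity.Theorems.EulerZoomLiouvillePowerGaugeEulerLiouvilleAxisymDSS
import HarnessLib

/-!
# The FINITE-ENERGY discretely self-similar stratum of the crux `EulerZoomLiouville.PowerGaugeEulerLiouville`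
# for CLASSICAL members (route №10, item stmt-NavierStokesRegularity-19832) — every `ρ ≠ 1/2`

Helper file (theorems only; `--supports stmt-NavierStokesRegularity-19832`). Seat ns-typeII-p3 (cell
ns-regularity-ideate §B, D-0081). Rung C2 (discretely self-similar members) of
`Cruxes/PowerGaugeEulerLiouville/Lines/rungC_window.lean`, no symmetry.

* `integral_norm_sq_eq_of_classical_euler` — **energy CONSERVATION for classical Euler flows on the
  open slab `(−∞,0)`**: if on `[s,t] ⊂ (−∞,0)` `u(τ) ∈ L² ∩ L³` and `p(τ)·u(τ) ∈ L¹` with uniform bounds, then `∫|u(t)|² = ∫|u(s)|²` (the tree's local energy identity against the cut-off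
  `χ_R`, `IsClassicalNSSolutionOn.local_energy_identity_cutoff` at `ν = 0`, and `R → ∞`: the flux
  `∫ Dχ_R(u)(|u|² + 2p)` is `O(1/R)`).
* `slice_eq_zero_of_dss_finiteEnergy` — under the class scaling `u(τ,·) = l^{1+ρ}u(l^{2+ρ}τ, l·)` the
  energy transforms by `l^{2ρ−1}`; conservation forces `E ≡ 0` unless `ρ = 1/2` (the energy-conserving
  Euler scaling `α = 3/2`), hence every slice vanishes identically;
* `powerGaugeEulerLiouville_dss_finiteEnergy` — the crux VERBATIM + «classical, DSS with `l > 1`,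
  `u ∈ L² ∩ L³`, `p·u ∈ L¹` on compact time intervals, `ρ ≠ 1/2`» ⇒ `u = 0` a.e. (the gauges are
  not even used). The exactly self-similar case is already in the tree in the WEAK class and is stronger
  there (crux lead ns-ezl-19832-p1 g3: `ProfileEnergy.profile_ae_eq_zero_of_energyEquality`, γ ≠ 2/5 ⟺
  ρ ≠ 1/2), so no self-similar corollary is stated here; the DSS (rung C2) case is the new content.

In print: Chae–Tsai, MRL 21 (2014) Thm 3.1 (time-periodic profile form: `V ∈ L²_sL²_y ∩ L³_sL^r_y`,
`3 ≤ r ≤ 9/2`, pressure = the Calderón–Zygmund pressure, `−1 < α < 3/2` or `α > 3/2`); Chae–Shvydkoy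
2013 §3 (self-similar). Here: member form, `u ∈ L² ∩ L³` and `p·u ∈ L¹` instead of the CZ formula. READING: a
finite-energy DSS Euler collapse in the window `0 < ρ < 1/2` must DISSIPATE energy anomalously between
consecutive scales (`E(τ) = l^{2ρ−1}E(l^{2+ρ}τ) < E(l^{2+ρ}τ)`), which a smooth member cannot do — the
survivors of this stratum are the WILD (non-classical) members and the energy-critical exponent
`ρ = 1/2`. WHAT THIS IS NOT: not NS, not the crux E, not rung C2 whole. [folklore]
-/

noncomputable section

-- the summit and its single problem share the name `NavierStokesRegularity` (D-0017 nested layout)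
set_option linter.dupNamespace false

open Set Function Filter Topology MeasureTheory Metric Module
open scoped NNReal ENNReal InnerProductSpace RealInnerProductSpace

namespace Summit.NavierStokesRegularity.NavierStokesRegularity.Theorems.PowerGaugeEulerLiouville.FiniteEnergy

open Literature.Analysis Literature.Analysis.FluidPDE
open Summit.NavierStokesRegularity.NavierStokesRegularity.Theorems.PowerGaugeEulerLiouville.AxisymNoSwirl

/-! ## Energy conservation for classical Euler flows on the open slab -/

/-- **Energy conservation for classical Euler flows on `(−∞, 0)`.** For `(u, p)` classical on the open
slab (`ν = 0`, `f = 0`) and `s < t < 0` such that on `[s, t]`: `u(τ) ∈ L² ∩ L³` and `p(τ)·u(τ) ∈ L¹`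
with `∫|u(τ)|², ∫|u(τ)|³, ∫|p(τ)|‖u(τ)‖ ≤ M`, one has `∫|u(t)|² = ∫|u(s)|²` (the energy flux
`(|u|² + 2p) u` is integrable, so the cut-off flux is `O(1/R)`). [folklore] -/
theorem integral_norm_sq_eq_of_classical_euler
    {u : ℝ → (EuclideanSpace ℝ (Fin 3)) → (EuclideanSpace ℝ (Fin 3))} {p : ℝ → (EuclideanSpace ℝ (Fin 3)) → ℝ}
    (hns : IsClassicalNSSolutionOn (Iio 0) 0 0 u p) {s t : ℝ} (hst : s < t) (ht : t < 0)
    {M : ℝ} (hE : ∀ τ ∈ Icc s t, Integrable (fun y => ‖u τ y‖ ^ 2) ∧ ∫ y, ‖u τ y‖ ^ 2 ≤ M)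
    (h3 : ∀ τ ∈ Icc s t, Integrable (fun y => ‖u τ y‖ ^ 3) ∧ ∫ y, ‖u τ y‖ ^ 3 ≤ M)
    (hP : ∀ τ ∈ Icc s t, Integrable (fun y => |p τ y| * ‖u τ y‖) ∧ ∫ y, |p τ y| * ‖u τ y‖ ≤ M) :
    ∫ y, ‖u t y‖ ^ 2 = ∫ y, ‖u s y‖ ^ 2 := by
  obtain ⟨C, hC0, hC⟩ := exists_norm_fderiv_cutoff_le (E := (EuclideanSpace ℝ (Fin 3)))
  have hI : Icc s t ⊆ Iio (0 : ℝ) := fun τ hτ => lt_of_le_of_lt hτ.2 ht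
  have hM0 : 0 ≤ M := (integral_nonneg fun y => sq_nonneg _).trans (hE t ⟨hst.le, le_rfl⟩).2
  -- the local energy identity against `χ_R`, `ν = 0`
  have hloc : ∀ n : ℕ, |(∫ x, cutoff ((n : ℝ) + 1) x * ‖u t x‖ ^ 2) -
      (∫ x, cutoff ((n : ℝ) + 1) x * ‖u s x‖ ^ 2)| ≤ C / ((n : ℝ) + 1) * (M + 2 * M) * (t - s) := by
    intro n
    have hR : (0 : ℝ) < (n : ℝ) + 1 := by positivity
    have hid := hns.local_energy_identity_cutoff isOpen_Iio (contDiff_cutoff ((n : ℝ) + 1))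
      (hasCompactSupport_cutoff hR) hst.le hI
    simp only [zero_mul, mul_zero, zero_add, add_zero] at hid
    rw [hid]
    have hbound : ∀ τ ∈ Set.uIoc s t, ‖∫ x, (fderiv ℝ (cutoff ((n : ℝ) + 1)) x (u τ x) * ‖u τ x‖ ^ 2 +
        2 * (p τ x * fderiv ℝ (cutoff ((n : ℝ) + 1)) x (u τ x)))‖ ≤
        C / ((n : ℝ) + 1) * (M + 2 * M) := by
      intro τ hτ
      rw [uIoc_of_le hst.le] at hτ
      have hτ' : τ ∈ Icc s t := ⟨hτ.1.le, hτ.2⟩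
      obtain ⟨h3i, h3b⟩ := h3 τ hτ'
      obtain ⟨hPi, hPb⟩ := hP τ hτ'
      -- pointwise bound by an integrable function
      have hpt : ∀ x, ‖fderiv ℝ (cutoff ((n : ℝ) + 1)) x (u τ x) * ‖u τ x‖ ^ 2 +
          2 * (p τ x * fderiv ℝ (cutoff ((n : ℝ) + 1)) x (u τ x))‖ ≤
          C / ((n : ℝ) + 1) * (‖u τ x‖ ^ 3 + 2 * (|p τ x| * ‖u τ x‖)) := by
        intro x
        have hD : ‖fderiv ℝ (cutoff ((n : ℝ) + 1)) x (u τ x)‖ ≤ C / ((n : ℝ) + 1) * ‖u τ x‖ :=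
          ((fderiv ℝ (cutoff ((n : ℝ) + 1)) x).le_opNorm _).trans
            (mul_le_mul_of_nonneg_right (hC _ hR x) (norm_nonneg _))
        have hCR : 0 ≤ C / ((n : ℝ) + 1) := by positivity
        calc ‖fderiv ℝ (cutoff ((n : ℝ) + 1)) x (u τ x) * ‖u τ x‖ ^ 2 +
              2 * (p τ x * fderiv ℝ (cutoff ((n : ℝ) + 1)) x (u τ x))‖
            ≤ ‖fderiv ℝ (cutoff ((n : ℝ) + 1)) x (u τ x) * ‖u τ x‖ ^ 2‖ +
              ‖2 * (p τ x * fderiv ℝ (cutoff ((n : ℝ) + 1)) x (u τ x))‖ := norm_add_le _ _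
          _ = ‖fderiv ℝ (cutoff ((n : ℝ) + 1)) x (u τ x)‖ * ‖u τ x‖ ^ 2 +
              2 * (|p τ x| * ‖fderiv ℝ (cutoff ((n : ℝ) + 1)) x (u τ x)‖) := by
                simp only [norm_mul, Real.norm_eq_abs, abs_pow, abs_norm, abs_two]
          _ ≤ C / ((n : ℝ) + 1) * ‖u τ x‖ * ‖u τ x‖ ^ 2 +
              2 * (|p τ x| * (C / ((n : ℝ) + 1) * ‖u τ x‖)) := by gcongr
          _ = C / ((n : ℝ) + 1) * (‖u τ x‖ ^ 3 + 2 * (|p τ x| * ‖u τ x‖)) := by ring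
      have hint : Integrable (fun x => C / ((n : ℝ) + 1) * (‖u τ x‖ ^ 3 + 2 * (|p τ x| * ‖u τ x‖))) :=
        (h3i.add (hPi.const_mul 2)).const_mul _
      refine (norm_integral_le_of_norm_le hint (Eventually.of_forall hpt)).trans ?_
      rw [integral_const_mul, integral_add h3i (hPi.const_mul 2), integral_const_mul]
      gcongr
    have h := intervalIntegral.norm_integral_le_of_norm_le_const hbound
    rw [Real.norm_eq_abs, abs_of_pos (sub_pos.2 hst)] at h
    exact h
  -- the limits `R → ∞`
  have hlim : Tendsto (fun n : ℕ => (∫ x, cutoff ((n : ℝ) + 1) x * ‖u t x‖ ^ 2) -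
      (∫ x, cutoff ((n : ℝ) + 1) x * ‖u s x‖ ^ 2)) atTop
      (𝓝 ((∫ x, ‖u t x‖ ^ 2) - ∫ x, ‖u s x‖ ^ 2)) :=
    (tendsto_integral_cutoff_mul (hE t ⟨hst.le, le_rfl⟩).1).sub
      (tendsto_integral_cutoff_mul (hE s ⟨le_rfl, hst.le⟩).1)
  have hbound : Tendsto (fun n : ℕ => C / ((n : ℝ) + 1) * (M + 2 * M) * (t - s)) atTop (𝓝 0) := by
    have h1 : Tendsto (fun n : ℕ => C / ((n : ℝ) + 1)) atTop (𝓝 0) :=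
      tendsto_const_nhds.div_atTop (tendsto_natCast_atTop_atTop.atTop_add tendsto_const_nhds)
    simpa using (h1.mul_const (M + 2 * M)).mul_const (t - s)
  have hzero : Tendsto (fun n : ℕ => (∫ x, cutoff ((n : ℝ) + 1) x * ‖u t x‖ ^ 2) -
      (∫ x, cutoff ((n : ℝ) + 1) x * ‖u s x‖ ^ 2)) atTop (𝓝 0) :=
    squeeze_zero_norm (fun n => by rw [Real.norm_eq_abs]; exact hloc n) hbound
  have heq := tendsto_nhds_unique hlim hzero
  linarith

/-! ## The energy under the class scaling -/

/-- `∫ |c • v(λ y)|² dy = c² λ⁻³ ∫ |v|²` (`λ > 0`). [folklore] -/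
theorem integral_norm_sq_smul_comp_smul (v : (EuclideanSpace ℝ (Fin 3)) → (EuclideanSpace ℝ (Fin 3)))
    (c : ℝ) {lam : ℝ} (hlam : 0 < lam) :
    ∫ y, ‖(fun z : (EuclideanSpace ℝ (Fin 3)) => c • v (lam • z)) y‖ ^ 2 = c ^ 2 * (lam ^ 3)⁻¹ * ∫ y, ‖v y‖ ^ 2 := by
  have h1 : (fun y : (EuclideanSpace ℝ (Fin 3)) => ‖(fun z : (EuclideanSpace ℝ (Fin 3)) => c • v (lam • z)) y‖ ^ 2) =
      fun y => c ^ 2 * (fun z : (EuclideanSpace ℝ (Fin 3)) => ‖v z‖ ^ 2) (lam • y) := by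
    funext y
    simp only [norm_smul, mul_pow, Real.norm_eq_abs, sq_abs]
  rw [h1, integral_const_mul, Measure.integral_comp_smul volume
      (fun z : (EuclideanSpace ℝ (Fin 3)) => ‖v z‖ ^ 2) lam,
    finrank_euclideanSpace_fin, abs_of_pos (inv_pos.2 (pow_pos hlam 3)), smul_eq_mul]
  ring

/-- The energy scaling factor of the class scaling: `(l^{1+ρ})² (l³)⁻¹ = l^{2ρ − 1}`. [folklore] -/
theorem energy_scaling_factor_eq {l ρ : ℝ} (hl : 0 < l) :
    (l ^ (1 + ρ)) ^ 2 * (l ^ (3 : ℕ))⁻¹ = l ^ (2 * ρ - 1) := by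
  rw [← Real.rpow_natCast (l ^ (1 + ρ)), ← Real.rpow_mul hl.le, ← Real.rpow_natCast l 3,
    ← Real.rpow_neg hl.le, ← Real.rpow_add hl]
  congr 1
  push_cast
  ring

/-! ## The finite-energy DSS stratum -/

/-- **Every slice of a finite-energy classical DSS member vanishes, `ρ ≠ 1/2`**: conservation gives
`E(τ) = E(l^{2+ρ}τ)`, the scaling gives `E(τ) = l^{2ρ−1} E(l^{2+ρ}τ)`, and `l^{2ρ−1} ≠ 1`. [folklore] -/
theorem slice_eq_zero_of_dss_finiteEnergy {ρ : ℝ} (hρ : 0 < ρ) (hρh : ρ ≠ 1 / 2)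
    {u : ℝ → (EuclideanSpace ℝ (Fin 3)) → (EuclideanSpace ℝ (Fin 3))} {p : ℝ → (EuclideanSpace ℝ (Fin 3)) → ℝ}
    (hns : IsClassicalNSSolutionOn (Iio 0) 0 0 u p)
    {l : ℝ} (hl : 1 < l)
    (hdss : ∀ τ : ℝ, τ < 0 → ∀ y, u τ y = (l ^ (1 + ρ)) • u ((l ^ (2 + ρ)) * τ) (l • y))
    (hEP : ∀ s t : ℝ, s < t → t < 0 → ∃ M : ℝ, ∀ τ ∈ Icc s t,
      (Integrable (fun y => ‖u τ y‖ ^ 2) ∧ ∫ y, ‖u τ y‖ ^ 2 ≤ M) ∧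
      (Integrable (fun y => ‖u τ y‖ ^ 3) ∧ ∫ y, ‖u τ y‖ ^ 3 ≤ M) ∧
      (Integrable (fun y => |p τ y| * ‖u τ y‖) ∧ ∫ y, |p τ y| * ‖u τ y‖ ≤ M))
    {τ : ℝ} (hτ : τ < 0) : u τ = 0 := by
  have hl0 : 0 < l := zero_lt_one.trans hl
  have hL : 1 < l ^ (2 + ρ) := Real.one_lt_rpow hl (by linarith)
  set τ' : ℝ := l ^ (2 + ρ) * τ with hτ'
  have hτ'τ : τ' < τ := by
    have : τ' - τ = (l ^ (2 + ρ) - 1) * τ := by rw [hτ']; ring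
    nlinarith
  have hτ'0 : τ' < 0 := hτ'τ.trans hτ
  -- scaling of the energy
  have hfun : u τ = fun y => (l ^ (1 + ρ)) • u τ' (l • y) := funext fun y => hdss τ hτ y
  have hscale : ∫ y, ‖u τ y‖ ^ 2 = l ^ (2 * ρ - 1) * ∫ y, ‖u τ' y‖ ^ 2 := by
    rw [hfun, integral_norm_sq_smul_comp_smul (u τ') _ hl0, energy_scaling_factor_eq hl0]
  -- conservation
  obtain ⟨M, hM⟩ := hEP τ' τ hτ'τ hτ
  have hcons := integral_norm_sq_eq_of_classical_euler hns hτ'τ hτ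
    (fun σ hσ => (hM σ hσ).1) (fun σ hσ => (hM σ hσ).2.1) (fun σ hσ => (hM σ hσ).2.2)
  -- `(l^{2ρ-1} - 1) E(τ') = 0`, `l^{2ρ-1} ≠ 1`
  rw [hcons] at hscale
  have hne : l ^ (2 * ρ - 1) ≠ 1 := by
    have hexp : 2 * ρ - 1 ≠ 0 := by
      intro h; apply hρh; linarith
    exact rpow_ne_one_of_one_lt hl hexp
  have hI : (l ^ (2 * ρ - 1) - 1) * ∫ y, ‖u τ' y‖ ^ 2 = 0 := by linarith
  have hE0 : ∫ y, ‖u τ' y‖ ^ 2 = 0 := by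
    rcases mul_eq_zero.1 hI with h | h
    · exact absurd (sub_eq_zero.1 h) hne
    · exact h
  have hEτ : ∫ y, ‖u τ y‖ ^ 2 = 0 := by rw [hcons, hE0]
  -- the slice vanishes: `∫ |u(τ)|² = 0` with `u(τ)` continuous
  obtain ⟨M₂, hM₂⟩ := hEP (2 * τ) τ (by linarith) hτ
  have hint : Integrable (fun y => ‖u τ y‖ ^ 2) := (hM₂ τ ⟨by linarith, le_rfl⟩).1.1
  have hcont : Continuous (fun y => ‖u τ y‖ ^ 2) := (hns.contDiff_velocity hτ).continuous.norm.pow 2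
  have hae : (fun y => ‖u τ y‖ ^ 2) =ᵐ[volume] 0 :=
    (integral_eq_zero_iff_of_nonneg (fun y => sq_nonneg _) hint).1 hEτ
  have hzero : (fun y => ‖u τ y‖ ^ 2) = 0 :=
    Continuous.ae_eq_iff_eq volume hcont continuous_const |>.1 hae
  funext y
  have := congrFun hzero y
  simpa using this

/-- **The finite-energy classical DSS stratum of the crux `PowerGaugeEulerLiouville`** (every `ρ > 0`,
`ρ ≠ 1/2`; rung C2, no symmetry): the crux VERBATIM with the extra hypotheses «classical on the open
slab, DSS with factor `l > 1`, and on compact time intervals `u ∈ L² ∩ L³` and `p·u ∈ L¹` with uniform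
bounds». The gauges are not used. [folklore] -/
theorem powerGaugeEulerLiouville_dss_finiteEnergy :
    ∀ ρ : ℝ, 0 < ρ → ρ ≠ 1 / 2 → ∀ (u : ℝ → EuclideanSpace ℝ (Fin 3) → EuclideanSpace ℝ (Fin 3))
      (p : ℝ → EuclideanSpace ℝ (Fin 3) → ℝ)
      (H : ℝ → EuclideanSpace ℝ (Fin 3) → EuclideanSpace ℝ (Fin 3) →L[ℝ] EuclideanSpace ℝ (Fin 3)) (c : ℝ≥0)
      (l : ℝ),
      IsSuitableWeakSolutionOn (slab (EuclideanSpace ℝ (Fin 3)) (Set.Iio 0) isOpen_Iio) 0 0 u p →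
      HasWeakSpatialGradientOn (slab (EuclideanSpace ℝ (Fin 3)) (Set.Iio 0) isOpen_Iio) u H →
      (∀ a : ℝ, 0 < a → ENNReal.ofReal (a ^ (2 * ρ)) * cknA a (0 : ℝ × EuclideanSpace ℝ (Fin 3)) u +
        ENNReal.ofReal (a ^ ρ) * cknE a (0 : ℝ × EuclideanSpace ℝ (Fin 3)) H +
        ENNReal.ofReal (a ^ (2 * ρ)) * cknD a (0 : ℝ × EuclideanSpace ℝ (Fin 3)) p ≤ (c : ℝ≥0∞)) →
      IsClassicalNSSolutionOn (Set.Iio 0) 0 0 u p →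
      1 < l →
      (∀ τ : ℝ, τ < 0 → ∀ y, u τ y = (l ^ (1 + ρ)) • u ((l ^ (2 + ρ)) * τ) (l • y)) →
      (∀ s t : ℝ, s < t → t < 0 → ∃ M : ℝ, ∀ τ ∈ Set.Icc s t,
        (Integrable (fun y => ‖u τ y‖ ^ 2) ∧ ∫ y, ‖u τ y‖ ^ 2 ≤ M) ∧
        (Integrable (fun y => ‖u τ y‖ ^ 3) ∧ ∫ y, ‖u τ y‖ ^ 3 ≤ M) ∧
        (Integrable (fun y => |p τ y| * ‖u τ y‖) ∧ ∫ y, |p τ y| * ‖u τ y‖ ≤ M)) →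
      Function.uncurry u =ᵐ[volume.restrict (Set.Iio (0 : ℝ) ×ˢ (Set.univ : Set (EuclideanSpace ℝ (Fin 3))))] 0 := by
  intro ρ hρ hρh u p H c l _ _ _ hns hl hdss hEP
  refine (ae_restrict_iff' (measurableSet_Iio.prod MeasurableSet.univ)).2
    (Eventually.of_forall fun z hz => ?_)
  have hz1 : z.1 < 0 := by simpa using hz.1
  have h := slice_eq_zero_of_dss_finiteEnergy hρ hρh hns hl hdss hEP hz1
  simp [uncurry, h]

/-- The stratum is a literal sub-case of the route decl `PowerGaugeEulerLiouville`. [folklore] -/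
theorem dss_finiteEnergy_of_powerGaugeEulerLiouville
    (hE : Summit.NavierStokesRegularity.NavierStokesRegularity.Theses.EulerZoomLiouville.PowerGaugeEulerLiouville) :
    ∀ ρ : ℝ, 0 < ρ → ρ ≠ 1 / 2 → ∀ (u : ℝ → EuclideanSpace ℝ (Fin 3) → EuclideanSpace ℝ (Fin 3))
      (p : ℝ → EuclideanSpace ℝ (Fin 3) → ℝ)
      (H : ℝ → EuclideanSpace ℝ (Fin 3) → EuclideanSpace ℝ (Fin 3) →L[ℝ] EuclideanSpace ℝ (Fin 3)) (c : ℝ≥0)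
      (l : ℝ),
      IsSuitableWeakSolutionOn (slab (EuclideanSpace ℝ (Fin 3)) (Set.Iio 0) isOpen_Iio) 0 0 u p →
      HasWeakSpatialGradientOn (slab (EuclideanSpace ℝ (Fin 3)) (Set.Iio 0) isOpen_Iio) u H →
      (∀ a : ℝ, 0 < a → ENNReal.ofReal (a ^ (2 * ρ)) * cknA a (0 : ℝ × EuclideanSpace ℝ (Fin 3)) u +
        ENNReal.ofReal (a ^ ρ) * cknE a (0 : ℝ × EuclideanSpace ℝ (Fin 3)) H +
        ENNReal.ofReal (a ^ (2 * ρ)) * cknD a (0 : ℝ × EuclideanSpace ℝ (Fin 3)) p ≤ (c : ℝ≥0∞)) →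
      IsClassicalNSSolutionOn (Set.Iio 0) 0 0 u p →
      1 < l →
      (∀ τ : ℝ, τ < 0 → ∀ y, u τ y = (l ^ (1 + ρ)) • u ((l ^ (2 + ρ)) * τ) (l • y)) →
      Function.uncurry u =ᵐ[volume.restrict (Set.Iio (0 : ℝ) ×ˢ (Set.univ : Set (EuclideanSpace ℝ (Fin 3))))] 0 :=
  fun ρ hρ _ u p H c _ hsw hH hc _ _ _ => hE ρ hρ u p H c hsw hH hc

end Summit.NavierStokesRegularity.NavierStokesRegularity.Theorems.PowerGaugeEulerLiouville.FiniteEnergy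

end
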